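import Literature.Analysis.OperatorTheory.GaussianTransferKernelSupersolution
import Literature.Analysis.OperatorTheory.GaussianTransferKernelFrame
import Mathlib.MeasureTheory.Measure.Haar.InnerProductSpace
import Mathlib.Analysis.InnerProductSpace.Spectrum
import HarnessLib

/-!
# The harmonic transfer kernel against a general (fattened) Gaussian weight — orthonormal-frame and symmetric-Hessian versions
# (companion of `GaussianTransferKernelSupersolution`; cf. `GaussianTransferKernelFrame`)

For an orthonormal frame `(eᵢ)` of a finite-dimensional real inner-product space `V` and exponents `aᵢ ≥ 0`, `c'ᵢ ≥ 0`, `b > 0`: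
`∫ e^{−Σaᵢ⟪eᵢ,x⟫²} e^{−b‖x−y‖²} e^{−Σaᵢ⟪eᵢ,y⟫²} e^{−Σc'ᵢ⟪eᵢ,y⟫²} dy = (Πᵢ √(π/s'ᵢ)) · e^{−Σκᵢ⟪eᵢ,x⟫²} · e^{−Σc'ᵢ⟪eᵢ,x⟫²}`, `s'ᵢ = aᵢ + b + c'ᵢ`,
`κᵢ = (aᵢ² + 2aᵢb − c'ᵢ²)/s'ᵢ` (`integral_gaussKernel_mul_gaussian_frame`), and the same in the eigenframe of a symmetric positive `A` with
`⟪x, Ax⟫ = Σ λᵢ⟪eᵢ,x⟫²` (`integral_gaussKernel_mul_gaussian_symm`).  At the Riccati exponents `c'ᵢ² = aᵢ² + 2aᵢb` all `κᵢ = 0` and this is the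
ground-state identity of `GaussianTransferKernelFrame`; for FATTER weights (`c'ᵢ < cᵢ`) every `κᵢ > 0` — a super-solution with anisotropic Gaussian gain,
the tool of the weighted Schur test on regions excluding a neighbourhood of the origin.
Source: A. Wipf, *Statistical Approach to Quantum Field Theory*, LNP 992 (2021) §8.5.1–8.5.2; L. Grafakos, *Modern Fourier Analysis*, App. A.2.
-/

noncomputable section

open MeasureTheory Real
open scoped RealInnerProductSpace

namespace Literature.Analysis.OperatorTheory.GaussianTransferKernel

variable {V : Type*} [NormedAddCommGroup V] [InnerProductSpace ℝ V] [FiniteDimensional ℝ V]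
  [MeasurableSpace V] [BorelSpace V]
variable {ι : Type*} [Fintype ι]

/-- The coordinate map of an orthonormal frame as a volume-preserving measurable equivalence `V ≃ᵐ (ι → ℝ)` (re-derived; the copy in
`GaussianTransferKernelFrame` is private). [folklore] -/
private theorem exists_coord' (e : OrthonormalBasis ι ℝ V) :
    ∃ Ψ : V ≃ᵐ (ι → ℝ), MeasurePreserving Ψ volume volume ∧ ∀ x i, Ψ x i = ⟪e i, x⟫ := by
  refine ⟨e.measurableEquiv.trans (MeasurableEquiv.toLp 2 (ι → ℝ)).symm,
    (e.measurePreserving_measurableEquiv).trans (EuclideanSpace.volume_preserving_symm_measurableEquiv_toLp ι), fun x i => ?_⟩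
  simp only [MeasurableEquiv.trans_apply]
  show (MeasurableEquiv.toLp 2 (ι → ℝ)).symm (e.repr x) i = ⟪e i, x⟫
  rw [← e.repr_apply_apply]
  rfl

omit [FiniteDimensional ℝ V] [MeasurableSpace V] [BorelSpace V] in
/-- `‖x − y‖² = Σᵢ (⟪eᵢ,x⟫ − ⟪eᵢ,y⟫)²`. [folklore] -/
private theorem norm_sub_sq_eq_sum' (e : OrthonormalBasis ι ℝ V) (x y : V) :
    ‖x - y‖ ^ 2 = ∑ i, (⟪e i, x⟫ - ⟪e i, y⟫) ^ 2 := by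
  rw [← e.sum_sq_inner_right (x - y)]
  simp only [inner_sub_right]

/-- ★ **General Gaussian weight in an orthonormal frame**: `aᵢ ≥ 0`, `b > 0`, `c'ᵢ ≥ 0` ⇒
`∫ e^{−Σaᵢ⟪eᵢ,x⟫²} e^{−b‖x−y‖²} e^{−Σaᵢ⟪eᵢ,y⟫²} e^{−Σc'ᵢ⟪eᵢ,y⟫²} dy = (Πᵢ √(π/(aᵢ+b+c'ᵢ))) · e^{−Σκᵢ⟪eᵢ,x⟫²} · e^{−Σc'ᵢ⟪eᵢ,x⟫²}`,
`κᵢ = (aᵢ² + 2aᵢb − c'ᵢ²)/(aᵢ + b + c'ᵢ)`. [cite: Wipf2021, §8.5.2 (8.64)–(8.67)] -/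
theorem integral_gaussKernel_mul_gaussian_frame (e : OrthonormalBasis ι ℝ V) {a c' : ι → ℝ} {b : ℝ} (ha : ∀ i, 0 ≤ a i)
    (hb : 0 < b) (hc' : ∀ i, 0 ≤ c' i) (x : V) :
    ∫ y, Real.exp (-(∑ i, a i * ⟪e i, x⟫ ^ 2)) * Real.exp (-(b * ‖x - y‖ ^ 2)) *
        Real.exp (-(∑ i, a i * ⟪e i, y⟫ ^ 2)) * Real.exp (-(∑ i, c' i * ⟪e i, y⟫ ^ 2)) =
      (∏ i, Real.sqrt (π / (a i + b + c' i))) *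
        Real.exp (-(∑ i, (a i ^ 2 + 2 * a i * b - c' i ^ 2) / (a i + b + c' i) * ⟪e i, x⟫ ^ 2)) *
          Real.exp (-(∑ i, c' i * ⟪e i, x⟫ ^ 2)) := by
  obtain ⟨Ψ, hΨ, hΨe⟩ := exists_coord' e
  set G : (ι → ℝ) → (ι → ℝ) → ℝ := fun x' y' =>
    Real.exp (-(∑ i, a i * x' i ^ 2)) * Real.exp (-(b * ∑ i, (x' i - y' i) ^ 2)) *
      Real.exp (-(∑ i, a i * y' i ^ 2)) * Real.exp (-(∑ i, c' i * y' i ^ 2)) with hG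
  have hpt : ∀ y, Real.exp (-(∑ i, a i * ⟪e i, x⟫ ^ 2)) * Real.exp (-(b * ‖x - y‖ ^ 2)) *
      Real.exp (-(∑ i, a i * ⟪e i, y⟫ ^ 2)) * Real.exp (-(∑ i, c' i * ⟪e i, y⟫ ^ 2)) = G (Ψ x) (Ψ y) := fun y => by
    simp only [hG, hΨe, norm_sub_sq_eq_sum' e x y]
  simp_rw [hpt]
  rw [hΨ.integral_comp Ψ.measurableEmbedding (g := fun y' => G (Ψ x) y')]
  rw [hG, integral_gaussKernel_mul_gaussian_pi ha hb hc' (Ψ x)]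
  simp only [hΨe]

variable {A : V →ₗ[ℝ] V} {n : ℕ}

/-- ★ **General Gaussian weight in the eigenframe of a symmetric `A ≥ 0`** (`⟪x,Ax⟫ = Σλᵢ⟪eᵢ,x⟫²`, `eᵢ` = `hA.eigenvectorBasis`, `λᵢ ≥ 0`):
`∫ e^{−⟪x,Ax⟫} e^{−b‖x−y‖²} e^{−⟪y,Ay⟫} e^{−Σc'ᵢ⟪eᵢ,y⟫²} dy = (Πᵢ √(π/(λᵢ+b+c'ᵢ))) · e^{−Σκᵢ⟪eᵢ,x⟫²} · e^{−Σc'ᵢ⟪eᵢ,x⟫²}`.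
[cite: Wipf2021, §8.5.2 (8.64)–(8.67)] [cite: HornJohnson2013, Thm 4.1.5] -/
theorem integral_gaussKernel_mul_gaussian_symm (hA : A.IsSymmetric) (hn : Module.finrank ℝ V = n)
    (hpos : ∀ i, 0 ≤ hA.eigenvalues hn i) {b : ℝ} (hb : 0 < b) {c' : Fin n → ℝ} (hc' : ∀ i, 0 ≤ c' i) (x : V) :
    ∫ y, Real.exp (-⟪x, A x⟫) * Real.exp (-(b * ‖x - y‖ ^ 2)) * Real.exp (-⟪y, A y⟫) *
        Real.exp (-(∑ i, c' i * ⟪hA.eigenvectorBasis hn i, y⟫ ^ 2)) =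
      (∏ i, Real.sqrt (π / (hA.eigenvalues hn i + b + c' i))) *
        Real.exp (-(∑ i, (hA.eigenvalues hn i ^ 2 + 2 * hA.eigenvalues hn i * b - c' i ^ 2) / (hA.eigenvalues hn i + b + c' i) *
          ⟪hA.eigenvectorBasis hn i, x⟫ ^ 2)) *
          Real.exp (-(∑ i, c' i * ⟪hA.eigenvectorBasis hn i, x⟫ ^ 2)) := by
  simp_rw [inner_self_apply_eq_sum_eigenvalues hA hn]
  exact integral_gaussKernel_mul_gaussian_frame (hA.eigenvectorBasis hn) hpos hb hc' x

end Literature.Analysis.OperatorTheory.GaussianTransferKernel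

end
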